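import Literature.NumberTheory.EllipticCurves.OrdinaryTorsionValuationProofs
import Literature.NumberTheory.EllipticCurves.PlaceOverInertiaOrbitProofs
import Literature.NumberTheory.EllipticCurves.PadicSigmaUniquenessOrdinaryProofs
import Literature.NumberTheory.EllipticCurves.MazurTorsionStepFourAtNProofs
import Summits.BirchSwinnertonDyer.Rank1Residual.Partition.EisensteinKernelReductionLine
import Summits.BirchSwinnertonDyer.Rank1Residual.Additive.CyclotomicThreeMultiplicativeReduction
import HarnessLib

/-!
# A rational `p`-line UNRAMIFIED at `p` has `p`-INTEGRAL points — at a good ordinary OR a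
# multiplicative prime (cell `b2b-bsdres`, unit `b2b-bsdres-eisenstein-p2`, gen 28)

HONEST FRAMING (run/shared/lean/b2b/bsd-rank1-residual/, verbatim in every file): the goal of the
cell is to DELETE the COMBINATION-SHAPED residual classes of the Birch–Swinnerton-Dyer formula for
ALL analytic-rank `≤ 1` elliptic curves over `ℚ` — "full BSD formula for every rank `≤ 1` curve in
class `C`" assembled STRICTLY from published theorems — so that the rank-`≤ 1` remainder becomes
exactly the CONSTRUCTION-SHAPED classes, which are TYPED (missing-input `Prop`s), NOT attempted.
This is not "finishing BSD". Research route; NO CLAIM BEYOND STATED CLASSES; nothing here changes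
a label. Theorems only; no definition, no named fact.

WHY. Greenberg–Vatsal's period clause Cor. (3.8) (registered fact A180,
`GreenbergVatsal2000.cor38_realPeriodRat_eq_unit_mul_of_isIsogenous_of_gvPar`, binder `hP` of the
X2a closure term) reduces, along the isogeny `E → E/Φ₀` by a rational `p`-line `Φ₀` UNRAMIFIED at
`p`, to the `p`-adic statement "the multiplier of an isogeny with étale kernel is a `p`-unit". Its
first input is the coordinate form of "unramified": the points of `Φ₀` are `p`-integral. At a GOOD
ORDINARY prime this is the lane's `KernelDisc.lineUnramifiedAt_iff_valuation_le_one`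
(`Partition/EisensteinKernelReductionLine`, via the reduction map). This file gives a proof that
works UNIFORMLY at a good ordinary and at a MULTIPLICATIVE prime (class X2), with no reduction map
at the bad prime: a `p`-torsion point `P = (x, y)` OFF the integral locus of the globally minimal
model (`|x|_𝔓 > 1` at the place `𝔓 = placeOver p` of `ℚ̄`) satisfies `|p|·|x|^{(p-1)/2} = 1`
(Serre 1972 §1.11, height one; tree `OrdinaryTorsionValuationProofs`, from the shape of `ψ_p`
when the Hasse invariant of `W_ℤ mod p` is non-zero — true at a good ordinary prime, `a_p ≡ A_p`,
and at a multiplicative one, `hasseCoeff_ne_zero_of_node`), hence `z = y/x` has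
`|z|^{p-1}·|p| = 1` (`|y|² = |x|³`), so `z` has at least `p - 1 ≥ 2` conjugates under the inertia
group `I_𝔓` (tree `exists_inertia_smul_injective_of_valuation_pow_mul_eq_one`: its minimal
polynomial over `ℚ_p^{nr}` has degree `≥ p - 1`), and some inertia element MOVES `P`.

* §1 `valuation_sq_eq_cube_of_one_lt` — `|y|² = |x|³` off the integral locus of an integral
  Weierstrass equation, for a valuation with values in any `Γ₀` (Silverman *AEC* VII.2);
* §2 `hasseCoeff_integralModelInt_ne_zero_of_mult` — the Hasse invariant of `W_ℤ mod p` is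
  non-zero at a multiplicative prime (nodal reduction, tree `hasseCoeff_ne_zero_of_node`); at a
  good ordinary prime this is the tree's `WeierstrassCurve.hasseCoeff_reduction_ne_zero`
  (`a_p ≡ A_p (mod p)`);
* §3 **`exists_inertia_smul_ne_of_prime_zsmul_eq_zero_of_one_lt`** — for `p` odd with
  `A_p(W_ℤ mod p) ≠ 0` and a `p`-torsion point `P = (x, y)` of `E(ℚ̄)` with `|x|_𝔓 > 1`, some
  `σ ∈ I_𝔓` has `σ P ≠ P`;
* §4 **`valuation_le_one_of_lineUnramifiedAt`** — hence every affine point of a rational `p`-line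
  UNRAMIFIED at `p` has `|x|_𝔓 ≤ 1`; forms `…_of_goodOrd`, **`…_of_mult`** (class X2).

References: [SerreInventiones1972] §1.11, §1.3; [SilvermanAEC2009] VII.2–VII.3, IV.6.1;
[GreenbergVatsal2000] §3 Cor. (3.8) (the consumer); HOME/b2b-bsdres-eisenstein-p2/X2-GAP.md §33.
-/

set_option autoImplicit false

noncomputable section

open scoped Classical NNReal

open WeierstrassCurve Polynomial IsDedekindDomain NumberField Field
  Literature.NumberTheory.EllipticCurves Literature.NumberTheory.EllipticCurves.Rank1Residual
  Literature.NumberTheory.GaloisRepresentations Rat.HeightOneSpectrum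

namespace Summit.BirchSwinnertonDyer.Rank1Residual.X2.UnramifiedLineIntegral

universe u

/-! ## §1. `|y|² = |x|³` off the integral locus -/

/-- **`|y|² = |x|³` for a point off the integral locus** of a Weierstrass equation with integral
coefficients (`|aᵢ| ≤ 1`), for a valuation with values in any linearly ordered group with zero:
in `y² + a₁xy + a₃y = x³ + a₂x² + a₄x + a₆` with `|x| > 1` the right side has valuation `|x|³`,
which forces `|y| > |x|` and then the left side has valuation `|y|²` (Silverman *AEC* VII.2:
`x = z⁻²(1 + …)`, `y = -z⁻³(1 + …)` on `E₁`). [cite: SilvermanAEC2009, Prop. VII.2.2] -/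
theorem valuation_sq_eq_cube_of_one_lt {L : Type u} [Field L] {Γ₀ : Type*}
    [LinearOrderedCommGroupWithZero Γ₀] (w : Valuation L Γ₀) (V : WeierstrassCurve L)
    (h₁ : w V.a₁ ≤ 1) (h₂ : w V.a₂ ≤ 1) (h₃ : w V.a₃ ≤ 1) (h₄ : w V.a₄ ≤ 1) (h₆ : w V.a₆ ≤ 1)
    {x y : L} (he : V.toAffine.Equation x y) (hx : 1 < w x) : w y ^ 2 = w x ^ 3 := by
  rw [Affine.equation_iff] at he
  have hx0 : w x ≠ 0 := ne_of_gt (lt_trans zero_lt_one hx)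
  have hxpos : 0 < w x := zero_lt_iff.mpr hx0
  -- the right-hand side has valuation `|x|³`
  have hR : w (x ^ 3 + V.toAffine.a₂ * x ^ 2 + V.toAffine.a₄ * x + V.toAffine.a₆) = w x ^ 3 := by
    have hlt : w (V.toAffine.a₂ * x ^ 2 + V.toAffine.a₄ * x + V.toAffine.a₆) < w (x ^ 3) := by
      rw [map_pow]
      have hx2 : w x ^ 2 < w x ^ 3 := pow_lt_pow_right₀ hx (by norm_num)
      refine lt_of_le_of_lt (w.map_add _ _) (max_lt (lt_of_le_of_lt (w.map_add _ _) (max_lt ?_ ?_)) ?_)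
      · rw [map_mul, map_pow]
        calc w V.toAffine.a₂ * w x ^ 2 ≤ 1 * w x ^ 2 := mul_le_mul' h₂ le_rfl
          _ = w x ^ 2 := one_mul _
          _ < w x ^ 3 := hx2
      · rw [map_mul]
        calc w V.toAffine.a₄ * w x ≤ 1 * w x := mul_le_mul' h₄ le_rfl
          _ = w x ^ 1 := by rw [one_mul, pow_one]
          _ < w x ^ 3 := pow_lt_pow_right₀ hx (by norm_num)
      · calc w V.toAffine.a₆ ≤ 1 := h₆
          _ < w x := hx
          _ = w x ^ 1 := (pow_one _).symm
          _ ≤ w x ^ 3 := pow_le_pow_right₀ hx.le (by norm_num)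
    have : x ^ 3 + V.toAffine.a₂ * x ^ 2 + V.toAffine.a₄ * x + V.toAffine.a₆ =
        x ^ 3 + (V.toAffine.a₂ * x ^ 2 + V.toAffine.a₄ * x + V.toAffine.a₆) := by ring
    rw [this, Valuation.map_add_eq_of_lt_left w hlt, map_pow]
  -- hence `|y| > |x|`
  have hyx : w x < w y := by
    by_contra hle
    rw [not_lt] at hle
    have hL : w (y ^ 2 + V.toAffine.a₁ * x * y + V.toAffine.a₃ * y) ≤ w x ^ 2 := by
      refine (w.map_add _ _).trans (max_le ((w.map_add _ _).trans (max_le ?_ ?_)) ?_)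
      · rw [map_pow]; exact pow_le_pow_left₀ zero_le hle 2
      · rw [map_mul, map_mul, sq]
        calc w V.toAffine.a₁ * w x * w y ≤ 1 * w x * w x :=
              mul_le_mul' (mul_le_mul' h₁ le_rfl) hle
          _ = w x * w x := by rw [one_mul]
      · rw [map_mul, sq]
        calc w V.toAffine.a₃ * w y ≤ 1 * w x := mul_le_mul' h₃ hle
          _ = w x := one_mul _
          _ ≤ w x * w x := le_mul_of_one_le_left zero_le hx.le
    rw [he, hR] at hL
    exact absurd hL (not_le.mpr (pow_lt_pow_right₀ hx (by norm_num)))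
  have hy1 : 1 < w y := hx.trans hyx
  -- and the left-hand side has valuation `|y|²`
  have hL : w (y ^ 2 + V.toAffine.a₁ * x * y + V.toAffine.a₃ * y) = w y ^ 2 := by
    have hlt : w (V.toAffine.a₁ * x * y + V.toAffine.a₃ * y) < w (y ^ 2) := by
      rw [map_pow, sq]
      have hy0 : 0 < w y := lt_trans zero_lt_one hy1
      refine lt_of_le_of_lt (w.map_add _ _) (max_lt ?_ ?_)
      · rw [map_mul, map_mul]
        calc w V.toAffine.a₁ * w x * w y ≤ 1 * w x * w y := by gcongr
          _ = w x * w y := by rw [one_mul]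
          _ < w y * w y := mul_lt_mul_of_pos_right hyx hy0
      · rw [map_mul]
        calc w V.toAffine.a₃ * w y ≤ 1 * w y := mul_le_mul' h₃ le_rfl
          _ = w y := one_mul _
          _ < w y * w y := lt_mul_of_one_lt_left hy0 hy1
    have : y ^ 2 + V.toAffine.a₁ * x * y + V.toAffine.a₃ * y =
        y ^ 2 + (V.toAffine.a₁ * x * y + V.toAffine.a₃ * y) := by ring
    rw [this, Valuation.map_add_eq_of_lt_left w hlt, map_pow]
  rw [← hL, he, hR]

/-! ## §2. The Hasse invariant of `W_ℤ mod p` at a multiplicative prime -/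

variable {W : WeierstrassCurve ℚ} [W.IsElliptic] [W.IsGloballyMinimal] {p : ℕ} [hp : Fact p.Prime]

/-- **MULTIPLICATIVE reduction ⇒ `A_p(W_ℤ mod p) ≠ 0`** (`p` odd): on the globally minimal model
`p ∣ Δ` and `p ∤ c₄` (Silverman *AEC* VII.5.1(b); cell theorem
`dvd_and_not_dvd_c₄_of_hasMultiplicativeReductionAtPrime`), so the reduction is a NODAL cubic, whose
Hasse invariant is non-zero (tree `hasseCoeff_ne_zero_of_node`: "the multiplicative group is
ordinary"). [cite: SilvermanAEC2009, VII.5 Prop. 5.1(b) and V.4.1(a)] -/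
theorem hasseCoeff_integralModelInt_ne_zero_of_mult (hp2 : p ≠ 2)
    (hmult : W.HasMultiplicativeReductionAtPrime p) :
    ((integralModelInt W).map (Int.castRingHom (ZMod p))).hasseCoeff p ≠ 0 := by
  obtain ⟨hΔ, hc₄⟩ := Additive.dvd_and_not_dvd_c₄_of_hasMultiplicativeReductionAtPrime W p hmult
  -- pass to the algebraic closure of `𝔽_p`
  set k := AlgebraicClosure (ZMod p) with hk
  haveI : CharP k p := (RingHom.charP_iff_charP (algebraMap (ZMod p) k) p).mp (ZMod.charP p)
  set V := (integralModelInt W).map ((algebraMap (ZMod p) k).comp (Int.castRingHom (ZMod p)))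
    with hV
  have hVΔ : V.Δ = 0 := by
    rw [hV, map_Δ, RingHom.comp_apply, eq_intCast]
    have : ((minimalDiscriminantInt W : ℤ) : ZMod p) = 0 :=
      (ZMod.intCast_zmod_eq_zero_iff_dvd _ p).mpr hΔ
    rw [minimalDiscriminantInt] at this
    rw [this, map_zero]
  have hVc₄ : V.c₄ ≠ 0 := by
    rw [hV, map_c₄, RingHom.comp_apply, eq_intCast, Ne, map_eq_zero_iff _ (algebraMap (ZMod p) k).injective,
      ZMod.intCast_zmod_eq_zero_iff_dvd]
    exact hc₄
  have hAk : V.hasseCoeff p ≠ 0 := hasseCoeff_ne_zero_of_node hp2 V hVΔ hVc₄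
  intro h0
  apply hAk
  rw [hV, ← WeierstrassCurve.map_map, map_hasseCoeff, h0, map_zero]

/-! ## §3. A `p`-torsion point off the integral locus is moved by inertia -/

omit [W.IsElliptic] [W.IsGloballyMinimal] in
/-- The Galois action on an affine point of `E(ℚ̄)` is coordinatewise (the tree's
`WeierstrassCurve.geomPoints.smul_some`, by `rfl`). [folklore] -/
private theorem smul_some_eq (σ : absoluteGaloisGroup ℚ) {x y : AlgebraicClosure ℚ}
    (h : (W.baseChange (AlgebraicClosure ℚ)).toAffine.Nonsingular x y) :
    ∃ h', σ • (show W.geomPoints from Affine.Point.some x y h) =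
      (show W.geomPoints from
        Affine.Point.some (absoluteGaloisGroup.toAlgEquiv ℚ σ x)
          (absoluteGaloisGroup.toAlgEquiv ℚ σ y) h') :=
  ⟨_, rfl⟩

omit [W.IsElliptic] in
/-- **A `p`-torsion point off the integral locus is moved by the inertia group** (`p` odd,
`A_p(W_ℤ mod p) ≠ 0`, i.e. good ordinary or multiplicative reduction at `p`).  For
`P = (x, y) ∈ E(ℚ̄)` with `p • P = O` and `|x|_𝔓 > 1` at the place `𝔓 = placeOver p`:
`|p|·|x|^{(p-1)/2} = 1` (`valuation_placeOver_mul_pow_eq_one_of_prime_zsmul_eq_zero`) and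
`|y|² = |x|³`, so `z = y/x` has `|z|^{p-1}·|p| = 1`; then `z` has `≥ p - 1 ≥ 2` conjugates under
`I_𝔓` (`exists_inertia_smul_injective_of_valuation_pow_mul_eq_one`, Serre 1972 §1.3), so some
`σ ∈ I_𝔓` moves `z`, hence moves `P`. This is the Galois half of "the canonical subgroup
`Ê[p] ≅ μ_p` is ramified" (Serre 1972, §1.11, Prop. 11 / Cor.: at `e = 1`, height `1`, the inertia
group acts on the kernel of reduction through the fundamental character of level `1`).
[cite: SerreInventiones1972, §1.11 (Prop. 11) and §1.3] -/
theorem exists_inertia_smul_ne_of_prime_zsmul_eq_zero_of_one_lt (hp2 : p ≠ 2)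
    (hA : ((integralModelInt W).map (Int.castRingHom (ZMod p))).hasseCoeff p ≠ 0)
    {P₀ : W.geomPoints} {x y : AlgebraicClosure ℚ}
    {h : (W.baseChange (AlgebraicClosure ℚ)).toAffine.Nonsingular x y}
    (hP₀ : P₀ = Affine.Point.some x y h) (hP : (p : ℤ) • P₀ = 0)
    (hx : 1 < (placeOver p).valuation x)
    {𝔓 : Ideal (absIntegers (𝓞 ℚ) ℚ)}
    (hmem : ∀ z : absIntegers (𝓞 ℚ) ℚ, z ∈ 𝔓 ↔ (z : AlgebraicClosure ℚ) ∈ (placeOver p).nonunits) :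
    ∃ σ ∈ 𝔓.inertia (absoluteGaloisGroup ℚ), σ • P₀ ≠ P₀ := by
  have hpP : p.Prime := hp.out
  set v := (placeOver p).valuation with hvdef
  have hP' : (p : ℤ) • (Affine.Point.some x y h : (W.baseChange (AlgebraicClosure ℚ)).toAffine.Point) = 0 := by
    rw [hP₀] at hP
    exact hP
  -- `|p| |x|^{(p-1)/2} = 1`
  have hlevel := valuation_placeOver_mul_pow_eq_one_of_prime_zsmul_eq_zero p W hp2 hA hP' hx
  -- `|y|² = |x|³` on the integral model
  have hint : ∀ n : ℤ, v (n : AlgebraicClosure ℚ) ≤ 1 := fun n ↦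
    ((placeOver p).valuation_le_one_iff _).mpr (intCast_mem _ n)
  have hcoef : ∀ a : ℤ, v (algebraMap ℚ (AlgebraicClosure ℚ) (a : ℚ)) ≤ 1 := fun a ↦ by
    rw [map_intCast]; exact hint a
  have hW : W.baseChange (AlgebraicClosure ℚ) =
      (integralModelInt W).map ((algebraMap ℚ (AlgebraicClosure ℚ)).comp (Int.castRingHom ℚ)) := by
    conv_lhs => rw [← map_integralModelInt W]
    rw [baseChange, WeierstrassCurve.map_map]
  have hsq : v y ^ 2 = v x ^ 3 := by
    refine valuation_sq_eq_cube_of_one_lt v (W.baseChange (AlgebraicClosure ℚ)) ?_ ?_ ?_ ?_ ?_ h.1 hx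
    all_goals rw [hW]; simp only [map_a₁, map_a₂, map_a₃, map_a₄, map_a₆,
      eq_intCast]; exact hcoef _
  -- `z = y / x` has `|z|^{p-1} |p| = 1`
  have hx0 : v x ≠ 0 := ne_of_gt (lt_trans zero_lt_one hx)
  have hxne : x ≠ 0 := fun h0 ↦ hx0 (by rw [h0, map_zero])
  set z : AlgebraicClosure ℚ := y / x with hz
  have hvz : v z ^ 2 = v x := by
    rw [hz, map_div₀, div_pow, hsq, pow_succ, mul_div_cancel_left₀ _ (pow_ne_zero 2 hx0)]
  obtain ⟨k, hk⟩ := hpP.odd_of_ne_two hp2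
  have hpm1 : p - 1 = 2 * k := by omega
  have hhalf : (p - 1) / 2 = k := by omega
  have hzpow : v z ^ (p - 1) * v (p : AlgebraicClosure ℚ) = 1 := by
    rw [hpm1, pow_mul, hvz, ← hhalf, mul_comm]
    exact hlevel
  -- at least `p - 1 ≥ 2` inertia conjugates of `z`
  have hd : 0 < p - 1 := by have := hpP.two_le; omega
  have h2 : 2 ≤ p - 1 := by have := hpP.two_le; omega
  obtain ⟨s, hsI, hinj⟩ :=
    exists_inertia_smul_injective_of_valuation_pow_mul_eq_one p hmem hd hzpow
  set i₀ : Fin (p - 1) := ⟨0, hd⟩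
  set i₁ : Fin (p - 1) := ⟨1, h2⟩
  have hne : s i₀ • z ≠ s i₁ • z := fun heq ↦ by
    have := hinj heq
    simp [i₀, i₁, Fin.ext_iff] at this
  -- one of `s i₀`, `s i₁` moves `z`, hence moves `P`
  have key : ∀ i, s i • P₀ = P₀ → s i • z = z := by
    intro i hi
    rw [hP₀] at hi
    obtain ⟨h', hsome⟩ := smul_some_eq (W := W) (s i) h
    obtain ⟨hxx, hyy⟩ := Affine.Point.some.inj (hsome.symm.trans hi)
    rw [Field.absoluteGaloisGroup.smul_def, hz, map_div₀, hxx, hyy]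
  by_cases h0 : s i₀ • P₀ = P₀
  · refine ⟨s i₁, hsI i₁, fun h1 ↦ hne ?_⟩
    rw [key i₀ h0, key i₁ h1]
  · exact ⟨s i₀, hsI i₀, h0⟩

/-! ## §4. Unramified rational `p`-lines have integral points -/

omit [W.IsElliptic] in
/-- **The affine points of a rational `p`-line UNRAMIFIED at `p` are `𝔓`-integral** (`p` odd,
`A_p(W_ℤ mod p) ≠ 0`): if `P = (x, y) ∈ Φ` had `|x|_𝔓 > 1`, an inertia element at the place's
prime `𝔓` would move it (§3), contradicting `LineUnramifiedAt`. Equivalently: an unramified line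
meets the kernel of reduction `E₁` (Silverman *AEC* VII.2) trivially.
[cite: SerreInventiones1972, §1.11 (Prop. 11)] -/
theorem valuation_le_one_of_lineUnramifiedAt (hp2 : p ≠ 2)
    (hA : ((integralModelInt W).map (Int.castRingHom (ZMod p))).hasseCoeff p ≠ 0)
    {Φ : AddSubgroup (geomTorsion W (p : ℤ))} (hunr : LineUnramifiedAt W p Φ)
    {P : geomTorsion W (p : ℤ)} (hPΦ : P ∈ Φ)
    {x y : AlgebraicClosure ℚ} {h : (W.baseChange (AlgebraicClosure ℚ)).toAffine.Nonsingular x y}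
    (hP : (P : W.geomPoints) = Affine.Point.some x y h) :
    (placeOver p).valuation x ≤ 1 := by
  have hpP : p.Prime := hp.out
  by_contra hx
  rw [not_le] at hx
  set v := (primesEquiv (R := 𝓞 ℚ)).symm ⟨p, hpP⟩ with hvdef
  have hvp : (primesEquiv v : ℕ) = p :=
    congrArg Subtype.val ((primesEquiv (R := 𝓞 ℚ)).apply_symm_apply ⟨p, hpP⟩)
  have hv : (p : 𝓞 ℚ) ∈ v.asIdeal := KernelDisc.natCast_mem_asIdeal_primesEquiv_symm
  obtain ⟨𝔓, hmem, h𝔓⟩ := exists_ideal_placeOver p hvp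
  have hPp : (p : ℤ) • (P : W.geomPoints) = 0 := (Submodule.mem_torsionBy_iff _ _).mp P.2
  obtain ⟨σ, hσ, hne⟩ :=
    exists_inertia_smul_ne_of_prime_zsmul_eq_zero_of_one_lt hp2 hA hP hPp hx hmem
  have hfix := hunr v hv 𝔓 h𝔓 σ hσ P hPΦ
  apply hne
  rw [← AddSubgroup.torsionBy.coe_smul, hfix]

omit [W.IsElliptic] in
/-- **At a GOOD ORDINARY odd prime `p`, the points of an unramified rational `p`-line are
`𝔓`-integral** (the lane's `KernelDisc.lineUnramifiedAt_iff_valuation_le_one`, forward direction,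
re-derived through the torsion valuation). [cite: SerreInventiones1972, §1.11 (Prop. 11)] -/
theorem valuation_le_one_of_lineUnramifiedAt_of_goodOrd (hp2 : p ≠ 2)
    (hgood : W.HasGoodReductionAtPrime p) (hord : ¬ (p : ℤ) ∣ W.frobeniusTrace p)
    {Φ : AddSubgroup (geomTorsion W (p : ℤ))} (hunr : LineUnramifiedAt W p Φ)
    {P : geomTorsion W (p : ℤ)} (hPΦ : P ∈ Φ)
    {x y : AlgebraicClosure ℚ} {h : (W.baseChange (AlgebraicClosure ℚ)).toAffine.Nonsingular x y}
    (hP : (P : W.geomPoints) = Affine.Point.some x y h) :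
    (placeOver p).valuation x ≤ 1 :=
  valuation_le_one_of_lineUnramifiedAt hp2 (W.hasseCoeff_reduction_ne_zero p hp2 hgood hord)
    hunr hPΦ hP

/-- **At a MULTIPLICATIVE odd prime `p` (class X2), the points of an unramified rational `p`-line
are `𝔓`-integral** — the multiplicative twin of the lane's good-ordinary criterion, with no
reduction map at the bad prime. [cite: SerreInventiones1972, §1.11 (Prop. 11)] -/
theorem valuation_le_one_of_lineUnramifiedAt_of_mult (hp2 : p ≠ 2)
    (hmult : W.HasMultiplicativeReductionAtPrime p)
    {Φ : AddSubgroup (geomTorsion W (p : ℤ))} (hunr : LineUnramifiedAt W p Φ)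
    {P : geomTorsion W (p : ℤ)} (hPΦ : P ∈ Φ)
    {x y : AlgebraicClosure ℚ} {h : (W.baseChange (AlgebraicClosure ℚ)).toAffine.Nonsingular x y}
    (hP : (P : W.geomPoints) = Affine.Point.some x y h) :
    (placeOver p).valuation x ≤ 1 :=
  valuation_le_one_of_lineUnramifiedAt hp2 (hasseCoeff_integralModelInt_ne_zero_of_mult hp2 hmult)
    hunr hPΦ hP

end Summit.BirchSwinnertonDyer.Rank1Residual.X2.UnramifiedLineIntegral

end
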